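import Summits.HodgeConjecture.CorCM.MultiFieldWeilFrameTransfer
import Summits.HodgeConjecture.CorCM.Census.OcticDecicWeilGDefect
import Summits.HodgeConjecture.CorCM.SexticDecicWeilFrameTransfer
import Summits.HodgeConjecture.CorCM.SexticOcticDecicWeilRealised
import HarnessLib

/-!
# COR-CM — `E × B₄ × B₅` over an octic and a decic CM field sharing `k` THROUGH THE MULTI-FIELD WEIL ENGINE: the two frames as a frame family,
# and the REALISED TUPLES — a realised rotation of the five decic pairs and transitivity on the four octic pairs, NO Galois hypothesis

Cell `pub-hodgecm2` (COR-CM), seat b30 gen 28 (2026-08-23); count-neutral own lane (stem `OcticDecicWeil*`), sequel of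
`Census/OcticDecicWeilGDefect.lean` and `CorCM/MultiFieldWeilFrameTransfer.lean`.  Theorems plus bookkeeping definitions (`e2`, `im2`, `realised2`,
`decOnly2`); no named fact, no `sorry`.
* §1 `e2 is e₂ e₃`, `im2`, `realised2` and the readings `he2_sign`, `he2_conj`, `hΦ2`;
* §2 `decOnly2` (gen 28ʼs `SexticOcticDecicWeil.perm_fin_four_pow_twelve` BY NAME), **`exists_rot_mem_realisedTuples2`** (a realised `5`-cycle `σ`, Cauchy — gen 23; `(π₂, σ)¹² = (1, σ²)`),
  **`rot_stable_realisedTuples2`** (`hrot`); §3 **`transitive_realisedTuples2`** (`ht`, `Aut(ℂ)` transitive on `Hom(K₂, ℂ)` — `ZarhinLie`);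
  §4 **`exists_hasDefectsG_realisedTuples2`** (`hdef`).
HONEST FRAMING: nothing about the Hodge conjecture is concluded here; `HC_CM` is not asserted.
[cite: Shimura1998, §18.2 Lemma (i)] [cite: DixonMortimer1996, §2.1] [cite: MoonenZarhin1995Duke, Thm. 2.4]

## References
* [Shimura1998] G. Shimura, *Abelian varieties with CM and modular functions*, §18.2 Lemma (i).  [DixonMortimer1996] J. D. Dixon, B. Mortimer,
  *Permutation Groups*, GTM 163, §2.1.  [MoonenZarhin1995Duke] B. Moonen, Yu. Zarhin, Duke Math. J. 77 (1995), Thm. 2.4.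
-/

noncomputable section

open CategoryTheory CategoryTheory.Limits NumberField

namespace Summit.HodgeConjecture.CorCM.OcticDecicWeilG

open Literature.AlgebraicGeometry Literature.AlgebraicGeometry.Motives Literature.AlgebraicGeometry.HodgeTheory
open Literature.NumberTheory.ComplexMultiplication
open Summit.HodgeConjecture.CorCM.Census.MultiFieldWeil
open Summit.HodgeConjecture.CorCM.Census.OcticDecicWeilG
open Summit.HodgeConjecture.CorCM.MultiFieldWeil
open Summit.HodgeConjecture.CorCM.SexticOcticWeil (exists_perm_of_comp_tau_eq_fin comp_tau_eq_of_realises_fin)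
open Summit.HodgeConjecture.CorCM.SexticDecicWeil (dihPerm_zero_one_eq_finRotate)
open Summit.HodgeConjecture.CorCM.SexticOcticDecicWeil (perm_fin_four_pow_twelve)
open Summit.HodgeConjecture.CorCM.DecicWeil23Pair (realisedPerms mem_realisedPerms exists_orderFive_mem_realisedPerms exists_conj_rot_of_orderFive)
open Summit.HodgeConjecture.CorCM.OcticCurveFourfold (comp_injective)

open scoped Classical

/-! ## §1 The two frames as a frame family -/

section Frames

variable {I : Type} {Kf : I → Type} [∀ i, Field (Kf i)] {i₀ : I} {is : Fin 2 → I}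

variable (is) in
/-- **The frame family** `(e₂; e₃)` of the generic model (`n2 = (4, 5)`); the slot assignment `is` is explicit. [folklore] -/
def e2 (e₂ : (Kf (is 0) →+* ℂ) ≃ Fin 4 × Bool) (e₃ : (Kf (is 1) →+* ℂ) ≃ Fin 5 × Bool) :
    ∀ m : Fin 2, (Kf (is m) →+* ℂ) ≃ Fin (n2 m) × Bool := fun m =>
  Fin.cases (motive := fun m => (Kf (is m) →+* ℂ) ≃ Fin (n2 m) × Bool) e₂
    (fun m => Fin.cases (motive := fun m : Fin 1 => (Kf (is m.succ) →+* ℂ) ≃ Fin (n2 m.succ) × Bool) e₃ (fun m => m.elim0) m) m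

variable (is) in
/-- **The embeddings of `k`** `(i₂; i₃)` as a family. [folklore] -/
def im2 (i₂ : Kf i₀ →+* Kf (is 0)) (i₃ : Kf i₀ →+* Kf (is 1)) : ∀ m : Fin 2, Kf i₀ →+* Kf (is m) := fun m =>
  Fin.cases (motive := fun m => Kf i₀ →+* Kf (is m)) i₂
    (fun m => Fin.cases (motive := fun m : Fin 1 => Kf i₀ →+* Kf (is m.succ)) i₃ (fun m => m.elim0) m) m

variable (e₂ : (Kf (is 0) →+* ℂ) ≃ Fin 4 × Bool) (e₃ : (Kf (is 1) →+* ℂ) ≃ Fin 5 × Bool) (i₂ : Kf i₀ →+* Kf (is 0)) (i₃ : Kf i₀ →+* Kf (is 1))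

/-- `e2 0 = e₂`. [folklore] -/
@[simp] theorem e2_zero : e2 is e₂ e₃ 0 = e₂ := rfl
/-- `e2 1 = e₃`. [folklore] -/
@[simp] theorem e2_one : e2 is e₂ e₃ 1 = e₃ := rfl
/-- `im2 0 = i₂`. [folklore] -/
@[simp] theorem im2_zero : im2 is i₂ i₃ 0 = i₂ := rfl
/-- `im2 1 = i₃`. [folklore] -/
@[simp] theorem im2_one : im2 is i₂ i₃ 1 = i₃ := rfl

variable (is) in
/-- **The realised tuples of the two frames** (the generic `realisedTuples` with the slot data made explicit). [folklore] -/
def realised2 (τ : Kf i₀ →+* ℂ) : Finset (PermsG n2) := realisedTuples (is := is) (n := n2) (e2 is e₂ e₃) τ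

variable {e₂ e₃ i₂ i₃} {τ : Kf i₀ →+* ℂ}

/-- The sign readings of the family. [folklore] -/
theorem he2_sign (he₂_sign : ∀ s, (e₂ s).2 = true ↔ s.comp i₂ = τ) (he₃_sign : ∀ s, (e₃ s).2 = true ↔ s.comp i₃ = τ) :
    ∀ (m : Fin 2) (s : Kf (is m) →+* ℂ), (e2 is e₂ e₃ m s).2 = true ↔ s.comp (im2 is i₂ i₃ m) = τ := fun m =>
  Fin.cases (motive := fun m => ∀ s : Kf (is m) →+* ℂ, (e2 is e₂ e₃ m s).2 = true ↔ s.comp (im2 is i₂ i₃ m) = τ) he₂_sign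
    (fun m => Fin.cases (motive := fun m : Fin 1 => ∀ s : Kf (is m.succ) →+* ℂ,
        (e2 is e₂ e₃ m.succ s).2 = true ↔ s.comp (im2 is i₂ i₃ m.succ) = τ) he₃_sign (fun m => m.elim0) m) m

/-- The conjugation readings of the family. [folklore] -/
theorem he2_conj (he₂_conj : ∀ s, e₂ (ComplexEmbedding.conjugate s) = ((e₂ s).1, !(e₂ s).2))
    (he₃_conj : ∀ s, e₃ (ComplexEmbedding.conjugate s) = ((e₃ s).1, !(e₃ s).2)) :
    ∀ (m : Fin 2) (s : Kf (is m) →+* ℂ), e2 is e₂ e₃ m (ComplexEmbedding.conjugate s) = ((e2 is e₂ e₃ m s).1, !(e2 is e₂ e₃ m s).2) := fun m =>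
  Fin.cases (motive := fun m => ∀ s : Kf (is m) →+* ℂ,
      e2 is e₂ e₃ m (ComplexEmbedding.conjugate s) = ((e2 is e₂ e₃ m s).1, !(e2 is e₂ e₃ m s).2)) he₂_conj
    (fun m => Fin.cases (motive := fun m : Fin 1 => ∀ s : Kf (is m.succ) →+* ℂ,
        e2 is e₂ e₃ m.succ (ComplexEmbedding.conjugate s) = ((e2 is e₂ e₃ m.succ s).1, !(e2 is e₂ e₃ m.succ s).2)) he₃_conj
      (fun m => m.elim0) m) m

variable {Φ : ∀ j : Fin (2 + 1), CMType (Kf (mfSlots i₀ is j))}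

/-- The type readings of the family at the position sets `P2 = ({0}, {0,1})` from the two one-line readings. [folklore] -/
theorem hΦ2 (hΦ₂ : ∀ s : Kf (is 0) →+* ℂ, s ∈ (Φ 1).1 ↔ (e₂ s).2 = decide ((e₂ s).1 = 0))
    (hΦ₃ : ∀ s : Kf (is 1) →+* ℂ, s ∈ (Φ 2).1 ↔ (e₃ s).2 = decide ((e₃ s).1 = 0 ∨ (e₃ s).1 = 1)) :
    ∀ (m : Fin 2) (s : Kf (is m) →+* ℂ), s ∈ (Φ m.succ).1 ↔ (e2 is e₂ e₃ m s).2 = decide ((e2 is e₂ e₃ m s).1 ∈ P2 m) := by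
  have h0 : ∀ s : Kf (is 0) →+* ℂ, s ∈ (Φ 1).1 ↔ (e2 is e₂ e₃ 0 s).2 = decide ((e2 is e₂ e₃ 0 s).1 ∈ P2 0) := fun s => by
    refine (hΦ₂ s).trans ?_
    show (e₂ s).2 = decide ((e₂ s).1 = 0) ↔ (e₂ s).2 = decide ((e₂ s).1 ∈ lowPos 4 1)
    have hd : decide ((e₂ s).1 ∈ lowPos 4 1) = decide ((e₂ s).1 = 0) := decide_eq_decide.2 mem_lowPos_one
    rw [hd]
  have h1 : ∀ s : Kf (is 1) →+* ℂ, s ∈ (Φ 2).1 ↔ (e2 is e₂ e₃ 1 s).2 = decide ((e2 is e₂ e₃ 1 s).1 ∈ P2 1) := fun s => by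
    refine (hΦ₃ s).trans ?_
    show (e₃ s).2 = decide ((e₃ s).1 = 0 ∨ (e₃ s).1 = 1) ↔ (e₃ s).2 = decide ((e₃ s).1 ∈ lowPos 5 2)
    have hd : decide ((e₃ s).1 ∈ lowPos 5 2) = decide ((e₃ s).1 = 0 ∨ (e₃ s).1 = 1) := decide_eq_decide.2 mem_lowPos_two
    rw [hd]
  intro m
  exact Fin.cases (motive := fun m => ∀ s : Kf (is m) →+* ℂ, s ∈ (Φ m.succ).1 ↔ (e2 is e₂ e₃ m s).2 = decide ((e2 is e₂ e₃ m s).1 ∈ P2 m))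
    h0 (fun m => Fin.cases (motive := fun m : Fin 1 => ∀ s : Kf (is m.succ) →+* ℂ,
      s ∈ (Φ m.succ.succ).1 ↔ (e2 is e₂ e₃ m.succ s).2 = decide ((e2 is e₂ e₃ m.succ s).1 ∈ P2 m.succ)) h1 (fun m => m.elim0) m) m

end Frames

/-! ## §2 A realised rotation of the five decic pairs, identity on the octic pairs -/

section Realised

variable {I : Type} {Kf : I → Type} [∀ i, Field (Kf i)] [∀ i, NumberField (Kf i)] {i₀ : I} {is : Fin 2 → I}
  {e₂ : (Kf (is 0) →+* ℂ) ≃ Fin 4 × Bool} {e₃ : (Kf (is 1) →+* ℂ) ≃ Fin 5 × Bool}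
  {i₂ : Kf i₀ →+* Kf (is 0)} {i₃ : Kf i₀ →+* Kf (is 1)} {τ : Kf i₀ →+* ℂ}
  (he₂_sign : ∀ s, (e₂ s).2 = true ↔ s.comp i₂ = τ) (he₃_sign : ∀ s, (e₃ s).2 = true ↔ s.comp i₃ = τ)

/-- **The tuple `(1, σ)`.** [folklore] -/
def decOnly2 (σ : Equiv.Perm (Fin 5)) : PermsG n2 := withDc2 1 σ

omit [∀ i, NumberField (Kf i)] in
/-- Right translation of the decic component is right multiplication by `(1, σ)`. [folklore] -/
theorem withDc2_eq_mul_decOnly2 (π : PermsG n2) (σ : Equiv.Perm (Fin 5)) : withDc2 π (dc2 π * σ) = π * decOnly2 σ := by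
  funext m
  refine Fin.cases ?_ (fun m => Fin.cases ?_ (fun m => m.elim0) m) m
  · show oc2 (withDc2 π (dc2 π * σ)) = oc2 π * oc2 (withDc2 1 σ)
    rw [oc2_withDc2, oc2_withDc2]; exact (mul_one _).symm
  · show dc2 (withDc2 π (dc2 π * σ)) = dc2 π * dc2 (withDc2 1 σ)
    rw [dc2_withDc2, dc2_withDc2]

include he₂_sign he₃_sign in
/-- **A conjugate rotation of the five decic pairs, paired with the identity on the octic pairs, is realised** (NO Galois hypothesis): a realised
`5`-cycle `σ` (Cauchy, gen 23), its realiser induces some `(π₂, σ)`, and `(π₂, σ)¹² = (1, σ²)` with `σ²` again of order `5`.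
[cite: Shimura1998, §18.2 Lemma (i)] [cite: DixonMortimer1996, §2.1] -/
theorem exists_rot_mem_realisedTuples2 : ∃ g : Equiv.Perm (Fin 5), decOnly2 (g * finRotate 5 * g⁻¹) ∈ realised2 is e₂ e₃ τ := by
  obtain ⟨σ, hσ, h5, h1⟩ := exists_orderFive_mem_realisedPerms (e := e₃) he₃_sign
  obtain ⟨ρ, hρ₃⟩ := (mem_realisedPerms e₃ σ).1 hσ
  have hρτ : (ρ : ℂ →+* ℂ).comp τ = τ := comp_tau_eq_of_realises_fin he₃_sign ρ hρ₃
  obtain ⟨π, hπ, hπρ⟩ := exists_mem_realisedTuples_of_comp_tau_eq (is := is) (n := n2) (e := e2 is e₂ e₃)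
    (he2_sign (is := is) he₂_sign he₃_sign) ρ hρτ
  have hdc : dc2 π = σ := by
    ext b : 1
    have h := hπρ 1 b
    have h' : (ρ : ℂ →+* ℂ).comp (e₃.symm (b, true)) = e₃.symm (dc2 π b, true) := h
    rw [hρ₃ b] at h'
    exact ((Prod.mk.inj (e₃.symm.injective h')).1).symm
  have hσ10 : σ ^ 10 = 1 := (pow_mul σ 5 2).trans (by rw [h5, one_pow])
  have hpow : π ^ (11 + 1) = decOnly2 (σ ^ 2) := by
    funext m
    refine Fin.cases ?_ (fun m => Fin.cases ?_ (fun m => m.elim0) m) m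
    · have h' : oc2 π ^ 12 = oc2 (withDc2 1 (σ ^ 2)) := by
        rw [oc2_withDc2, perm_fin_four_pow_twelve]; rfl
      exact h'
    · have h' : dc2 π ^ 12 = dc2 (withDc2 1 (σ ^ 2)) := by
        rw [dc2_withDc2, hdc]
        exact (pow_add σ 10 2).trans (by rw [hσ10, one_mul])
      exact h'
  have h5' : (σ ^ 2) ^ 5 = 1 := (pow_mul σ 2 5).symm.trans hσ10
  have h6 : σ ^ 6 = σ := (pow_succ σ 5).trans (by rw [h5, one_mul])
  have h1' : σ ^ 2 ≠ 1 := fun h => h1 (by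
    have h' : σ ^ 6 = 1 := (pow_mul σ 2 3).trans (by rw [h, one_pow])
    rw [h6] at h'
    exact h')
  obtain ⟨g, hg⟩ := exists_conj_rot_of_orderFive (σ ^ 2) h5' h1'
  refine ⟨g, ?_⟩
  rw [← dihPerm_zero_one_eq_finRotate, hg, ← hpow]
  exact pow_mem_realisedTuples (is := is) (n := n2) (e2 is e₂ e₃) τ hπ 11

include he₂_sign he₃_sign in
/-- **The realised tuples are stable under right translation of the decic component by a realised conjugate rotation** (`hrot`). [cite: DixonMortimer1996, §2.1] -/
theorem rot_stable_realisedTuples2 : ∃ g : Equiv.Perm (Fin 5),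
    ∀ π ∈ realised2 is e₂ e₃ τ, withDc2 π (dc2 π * (g * finRotate 5 * g⁻¹)) ∈ realised2 is e₂ e₃ τ := by
  obtain ⟨g, hg⟩ := exists_rot_mem_realisedTuples2 he₂_sign he₃_sign
  refine ⟨g, fun π hπ => ?_⟩
  rw [withDc2_eq_mul_decOnly2]
  exact mul_mem_realisedTuples (is := is) (n := n2) (e2 is e₂ e₃) τ hπ hg

/-! ## §3 Transitivity on the octic pairs -/

include he₂_sign he₃_sign in
/-- **Every octic pair is moved to `0` by a realised tuple** (`ht`): an automorphism of `ℂ` carrying `e₂⁻¹(y, +)` to `e₂⁻¹(0, +)` exists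
(`ZarhinLie.exists_ringEquiv_complex_comp_eq`, the octic field is countable); it fixes `τ`. NO Galois hypothesis. [cite: Shimura1998, §18.2 Lemma (i)] -/
theorem transitive_realisedTuples2 : ∀ y : Fin 4, ∃ π ∈ realised2 is e₂ e₃ τ, oc2 π y = 0 := by
  intro y
  haveI : Countable (Kf (is 0)) := Countable.of_equiv _ (Module.finBasis ℚ (Kf (is 0))).equivFun.toEquiv.symm
  obtain ⟨ρ, hρ⟩ := ZarhinLie.exists_ringEquiv_complex_comp_eq (e₂.symm (y, true)) (e₂.symm (0, true))
  have hy : (ρ : ℂ →+* ℂ).comp (e₂.symm (y, true)) = e₂.symm (0, true) := RingHom.ext fun z => hρ z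
  have hρτ : (ρ : ℂ →+* ℂ).comp τ = τ := by
    have hy' : (e₂.symm (y, true)).comp i₂ = τ := (he₂_sign _).1 (by rw [Equiv.apply_symm_apply])
    have h0 : (e₂.symm ((0 : Fin 4), true)).comp i₂ = τ := (he₂_sign _).1 (by rw [Equiv.apply_symm_apply])
    calc (ρ : ℂ →+* ℂ).comp τ = ((ρ : ℂ →+* ℂ).comp (e₂.symm (y, true))).comp i₂ := by rw [RingHom.comp_assoc, hy']
      _ = τ := by rw [hy, h0]
  obtain ⟨π, hπ, hπρ⟩ := exists_mem_realisedTuples_of_comp_tau_eq (is := is) (n := n2) (e := e2 is e₂ e₃)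
    (he2_sign (is := is) he₂_sign he₃_sign) ρ hρτ
  refine ⟨π, hπ, ?_⟩
  have h := hπρ 0 y
  change (ρ : ℂ →+* ℂ).comp (e₂.symm (y, true)) = e₂.symm (oc2 π y, true) at h
  rw [hy] at h
  exact ((Prod.mk.inj (e₂.symm.injective h)).1).symm

/-! ## §4 The defect law for the realised tuples -/

include he₂_sign he₃_sign in
/-- **Every configuration balanced under the realised tuples of an octic and a decic CM field through `k` obeys the defect law with curve
multiplicities `(2, 1)`** — the hypothesis `hdef` of the generic headline, NO Galois hypothesis. [cite: MoonenZarhin1995Duke, Thm. 2.4] -/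
theorem exists_hasDefectsG_realisedTuples2 {α : Type} (v : α → PtG n2) (T : Finset α)
    (hT : ModelBalancedG P2 (realised2 is e₂ e₃ τ) v T) : ∃ t : Fin 2 → ℤ, HasDefectsG c2 v T t := by
  obtain ⟨g, hrot⟩ := rot_stable_realisedTuples2 he₂_sign he₃_sign
  exact exists_hasDefectsG_of_modelBalancedG2 g hrot (transitive_realisedTuples2 he₂_sign he₃_sign) hT

end Realised

end Summit.HodgeConjecture.CorCM.OcticDecicWeilG

end
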